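import Summits.SmoothPoincare4.SmoothPoincare4.Theorems.CongruenceShadowsShadowApproximationStubFramingZeroLattice
import Summits.SmoothPoincare4.SmoothPoincare4.Theorems.CongruenceShadowsShadowApproximationEpiClassLivingstonDefs

/-!
# Stub `stub_framingZero` of line `epi-class-livingston` for crux `CongruenceShadows.ShadowApproximation`
(item stmt-SmoothPoincare4-14595, route route-SmoothPoincare4-CongruenceShadows) — part C:
prime levels of `S₃` and abelian standardness of a normalised, shadow-standard triple

Third support file of `stub_framingZero` (imports parts A–B).  Contents, fully proved:

* the prime levels `Mp p = ker (abp p : S₃ → (ZMod p)⁶) = [S₃,S₃]·S₃ᵖ` — characteristic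
  (automorphisms of `S₃` act on `(ZMod p)⁶` through `abelp`/`abelpEquiv`) and of finite index —
  and `redSub_L_eq_of_level` : a level-`p` shadow identity `ψ(N ⊔ M_p) = K ⊔ M_p` reads
  `abelp ψ (L̄ N) = L̄ K` on the reduced lattices (cf. the mod-5 template `M5` of
  `Negative/UnitTwist.lean`);
* the three inputs of part B for the abelianised triple `Λᵢ = L Kᵢ` of a `(3,1)` group trisection
  `K` of `{1}`: (u) `exists_shared_vector` from Waldhausen pairs (`α(Nᵢ, Nⱼ) = (Kᵢ, Kⱼ)` carries the
  shared generator `a_k ∈ Nᵢ ∩ Nⱼ` to a vector of `L Kᵢ ∩ L Kⱼ` nonzero mod every `p`),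
  (w) `exists_private_vector` from the pair quotients `S₃ ⧸ ⟪Kⱼ ∪ Kₗ⟫ ≅ F₁ ↠ ℤ` and
  `K₀K₁K₂ = S₃` (`triple`), (p) `exists_level_equiv` from standard shadows at the levels `M_p`;
* the registered statement **`exists_adapted_equiv_of_shadows`**: for a `(3,1)` group trisection
  `K` of the trivial group that is Waldhausen-normalised and shadow-standard in every characteristic
  finite quotient, `(L K₀, L K₁, L K₂) = g (C₀, C₁, C₂)` for some `g ∈ GL₆(ℤ)` — abelian
  standardness, obtained from the congruence data alone (no class-number input);
* `mem_range_pi_of_commutator` (needs only the line vocabulary `H 0 i`, `T 0` of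
  `…EpiClassLivingstonDefs`): the lattice identity `[S₃,S₃] ≤ Kᵢ(Kⱼ ∩ Kₗ)` puts
  `γ₂(H₀) × γ₂(H₁) × γ₂(H₂)` inside the joint image of any kernel-`K` triple of epimorphisms
  `S₃ ↠ H 0 i`;
* `surv i` / `survIdx` / `survEquiv` — the generators surviving in `S₃ ⧸ Nᵢ` (complement of
  `s4Gens i`), enumerated, for the final file. [folklore]
-/

-- the prescribed namespace `Summit.<P>.<Sub>.…` duplicates `SmoothPoincare4` (P = Sub)
set_option linter.dupNamespace false
noncomputable section
open Literature.Topology.FourManifolds Multiplicative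

namespace Summit.SmoothPoincare4.SmoothPoincare4.Theorems.ShadowApproximation.EpiClassLivingston

section level

variable (p : ℕ)

/-- `abp = red ∘ ab : S₃ → (ZMod p)⁶` (mod-`p` abelianisation). -/
def abp : SurfaceGroup 3 →* Multiplicative (V3p p) :=
  (AddMonoidHom.toMultiplicative (red p).toAddMonoidHom).comp ab

/-- `abp` unfolded. [folklore] -/
@[simp] theorem toAdd_abp (s : SurfaceGroup 3) : toAdd (abp p s) = red p (toAdd (ab s)) := rfl

/-- **The level `M_p = ker (S₃ → (ZMod p)⁶) = [S₃,S₃]·S₃ᵖ`.** -/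
def Mp : Subgroup (SurfaceGroup 3) := (abp p).ker

/-- Membership in `M_p`. [folklore] -/
theorem mem_Mp {s : SurfaceGroup 3} : s ∈ Mp p ↔ red p (toAdd (ab s)) = 0 := by
  rw [Mp, MonoidHom.mem_ker, ← toAdd_abp]
  exact ⟨fun h => by rw [h]; rfl, fun h => by rw [← ofAdd_toAdd (abp p s), h]; rfl⟩

/-- The endomorphism of `(ZMod p)⁶` induced by an endomorphism of `S₃`. -/
def abelp (φ : SurfaceGroup 3 →* SurfaceGroup 3) : V3p p →ₗ[ZMod p] V3p p :=
  Fintype.linearCombination (ZMod p) fun x => red p (abel φ (e3 x))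

/-- `abelp φ ∘ red = red ∘ abel φ`. [folklore] -/
theorem abelp_red (φ : SurfaceGroup 3 →* SurfaceGroup 3) (v : V3) :
    abelp p φ (red p v) = red p (abel φ v) := by
  have key : ((abelp p φ).restrictScalars ℤ) ∘ₗ red p = red p ∘ₗ abel φ := by
    refine (Pi.basisFun ℤ (surfaceGen 3)).ext fun x => ?_
    rw [Pi.basisFun_apply, LinearMap.comp_apply, LinearMap.comp_apply, LinearMap.restrictScalars_apply]
    change abelp p φ (red p (e3 x)) = red p (abel φ (e3 x))
    rw [red_e3, abelp, Fintype.linearCombination_apply_single, one_smul]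
  exact LinearMap.congr_fun key v

/-- `abp (φ s) = abelp φ (abp s)`. [folklore] -/
theorem abp_map (φ : SurfaceGroup 3 →* SurfaceGroup 3) (s : SurfaceGroup 3) :
    toAdd (abp p (φ s)) = abelp p φ (toAdd (abp p s)) := by
  rw [toAdd_abp, toAdd_abp, abelp_red, abel_ab]

/-- Functoriality of `abelp`. [folklore] -/
theorem abelp_comp (φ ψ : SurfaceGroup 3 →* SurfaceGroup 3) :
    abelp p (φ.comp ψ) = abelp p φ ∘ₗ abelp p ψ := by
  refine LinearMap.ext fun w => ?_
  obtain ⟨v, rfl⟩ := red_surjective p w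
  rw [LinearMap.comp_apply, abelp_red, abelp_red, abelp_red, abel_comp, LinearMap.comp_apply]

/-- Functoriality of `abelp`. [folklore] -/
theorem abelp_id : abelp p (MonoidHom.id _) = LinearMap.id := by
  refine LinearMap.ext fun w => ?_
  obtain ⟨v, rfl⟩ := red_surjective p w
  rw [abelp_red, abel_id]; rfl

/-- The automorphism of `(ZMod p)⁶` induced by an automorphism of `S₃`. -/
def abelpEquiv (α : SurfaceGroup 3 ≃* SurfaceGroup 3) : V3p p ≃ₗ[ZMod p] V3p p :=
  LinearEquiv.ofLinear (abelp p α.toMonoidHom) (abelp p α.symm.toMonoidHom)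
    (by rw [← abelp_comp]; convert abelp_id p; ext; simp)
    (by rw [← abelp_comp]; convert abelp_id p; ext; simp)

/-- `abelpEquiv α` acts as `abelp α`. [folklore] -/
@[simp] theorem abelpEquiv_apply (α : SurfaceGroup 3 ≃* SurfaceGroup 3) (w : V3p p) :
    abelpEquiv p α w = abelp p α.toMonoidHom w := rfl

/-- `M_p` is characteristic (automorphisms of `S₃` act on `(ZMod p)⁶` compatibly). [folklore] -/
instance Mp_characteristic : (Mp p).Characteristic := by
  refine Subgroup.characteristic_iff_le_comap.2 fun φ s hs => ?_
  rw [Subgroup.mem_comap, MulEquiv.coe_toMonoidHom, mem_Mp, ← toAdd_abp,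
    show φ s = φ.toMonoidHom s from rfl, abp_map, toAdd_abp, (mem_Mp p).1 hs, map_zero]

/-- `M_p` has finite index (at most `p⁶`) for `p ≠ 0`. [folklore] -/
instance Mp_finiteIndex [NeZero p] : (Mp p).FiniteIndex := by
  unfold Mp; infer_instance

/-- Membership in the reduced lattice `redSub p (L K)` = image of `K` under `abp`. [folklore] -/
theorem mem_redSub_L {K : Subgroup (SurfaceGroup 3)} {w : V3p p} :
    w ∈ redSub p (L K) ↔ ofAdd w ∈ K.map (abp p) := by
  rw [mem_redSub, Subgroup.mem_map]
  constructor
  · rintro ⟨v, hv, rfl⟩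
    obtain ⟨k, hk, hkv⟩ := mem_L.1 hv
    exact ⟨k, hk, by rw [← ofAdd_toAdd (abp p k), toAdd_abp, hkv, toAdd_ofAdd]⟩
  · rintro ⟨k, hk, hkw⟩
    exact ⟨toAdd (ab k), toAdd_ab_mem_L hk, by rw [← toAdd_abp, hkw, toAdd_ofAdd]⟩

/-- **Reading a level-`p` shadow.** If `ψ(N ⊔ M_p) = K ⊔ M_p` then `abelp ψ` carries the reduced
lattice of `N` to that of `K` in `(ZMod p)⁶`. [folklore] -/
theorem redSub_L_eq_of_level (ψ : SurfaceGroup 3 ≃* SurfaceGroup 3) (N' K : Subgroup (SurfaceGroup 3))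
    (h : (N' ⊔ Mp p).map ψ.toMonoidHom = K ⊔ Mp p) :
    (redSub p (L N')).map (abelpEquiv p ψ : V3p p →ₗ[ZMod p] V3p p) = redSub p (L K) := by
  -- push the identity of subgroups of `S₃` forward along `abp`
  let ψhat : Multiplicative (V3p p) →* Multiplicative (V3p p) :=
    AddMonoidHom.toMultiplicative (abelp p ψ.toMonoidHom).toAddMonoidHom
  have hcomm : (abp p).comp ψ.toMonoidHom = ψhat.comp (abp p) :=
    MonoidHom.ext fun s => abp_map p ψ.toMonoidHom s
  have hM : (Mp p).map (abp p) = ⊥ := by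
    rw [Subgroup.map_eq_bot_iff]; exact le_of_eq rfl
  have key : (N'.map (abp p)).map ψhat = K.map (abp p) := by
    have := congrArg (Subgroup.map (abp p)) h
    rw [Subgroup.map_map, hcomm, ← Subgroup.map_map, Subgroup.map_sup, Subgroup.map_sup,
      Subgroup.map_sup, hM, Subgroup.map_bot, sup_bot_eq, sup_bot_eq] at this
    exact this
  ext w
  simp only [Submodule.mem_map, LinearEquiv.coe_coe, abelpEquiv_apply, mem_redSub_L, ← key,
    Subgroup.mem_map (f := ψhat)]
  constructor
  · rintro ⟨y, hy, rfl⟩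
    exact ⟨ofAdd y, hy, rfl⟩
  · rintro ⟨z, hz, hzw⟩
    exact ⟨toAdd z, hz, by rw [← toAdd_ofAdd w, ← hzw]; rfl⟩

end level

/-! ## Abelian standardness of a normalised, shadow-standard `(3,1)` trisection of `{1}` -/

/-- Two distinct standard generator sets share a generator. [folklore] -/
private theorem s4Gens_share : ∀ i j : Fin 3, i ≠ j → ∃ x, x ∈ s4Gens i ∧ x ∈ s4Gens j := by decide

/-- (u) **Shared vectors from Waldhausen pairs.** If one automorphism `α` carries `(Nᵢ, Nⱼ)` to
`(Kᵢ, Kⱼ)`, the shared generator `a_k ∈ Nᵢ ∩ Nⱼ` gives `ab (α a_k) ∈ L Kᵢ ∩ L Kⱼ`, nonzero modulo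
every prime (`abelp α` is invertible). [folklore] -/
theorem exists_shared_vector (K : TrisectionKernels 3)
    (hP : ∀ i j : Fin 3, i ≠ j → ∃ α : SurfaceGroup 3 ≃* SurfaceGroup 3,
      (s4Kernels i).map α.toMonoidHom = K i ∧ (s4Kernels j).map α.toMonoidHom = K j)
    (i j : Fin 3) (hij : i < j) :
    ∃ u, u ∈ L (K i) ∧ u ∈ L (K j) ∧ ∀ p : ℕ, p.Prime → red p u ≠ 0 := by
  obtain ⟨α, hi, hj⟩ := hP i j (ne_of_lt hij)
  obtain ⟨x, hxi, hxj⟩ := s4Gens_share i j (ne_of_lt hij)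
  refine ⟨toAdd (ab (α (PresentedGroup.of x))), ?_, ?_, fun p hp h0 => ?_⟩
  · rw [← hi]; exact toAdd_ab_mem_L ⟨_, of_mem_s4Kernels i hxi, rfl⟩
  · rw [← hj]; exact toAdd_ab_mem_L ⟨_, of_mem_s4Kernels j hxj, rfl⟩
  · haveI : Fact p.Prime := ⟨hp⟩
    have h1 : red p (toAdd (ab (α (PresentedGroup.of x)))) = abelpEquiv p α (Pi.single x 1) := by
      rw [abelpEquiv_apply, ← red_e3, abelp_red, abel_e3]; rfl
    rw [h1, LinearEquiv.map_eq_zero_iff] at h0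
    exact (one_ne_zero (α := ZMod p)) (by simpa using congr_fun h0 x)

/-- Three pairwise distinct elements exhaust `Fin 3`. [folklore] -/
private theorem fin_three_others : ∀ i : Fin 3, ∃ j l : Fin 3, j ≠ l ∧ j ≠ i ∧ l ≠ i ∧
    ∀ t : Fin 3, t ≠ i → t = j ∨ t = l := by decide

/-- `K₀ ⊔ K₁ ⊔ K₂ = ⊤` for a trisection of the trivial group (any labelling). [folklore] -/
theorem sup_sup_eq_top_of_isGroupTrisection {K : TrisectionKernels 3}
    (hK : IsGroupTrisection 3 1 (PUnit : Type) K) (i j l : Fin 3) (h : ∀ t : Fin 3, t ≠ i → t = j ∨ t = l) :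
    K i ⊔ K j ⊔ K l = ⊤ := by
  haveI : ∀ t, (K t).Normal := hK.normal
  obtain ⟨e⟩ := hK.triple
  have hsub : Subsingleton K.tripleQuotient := e.toEquiv.subsingleton
  rw [QuotientGroup.subsingleton_iff] at hsub
  rw [eq_top_iff, ← hsub]
  refine Subgroup.normalClosure_le_normal fun x hx => ?_
  obtain ⟨t, ht⟩ := Set.mem_iUnion.mp hx
  by_cases hti : t = i
  · subst hti; exact Subgroup.mem_sup_left (Subgroup.mem_sup_left ht)
  · rcases h t hti with rfl | rfl
    · exact Subgroup.mem_sup_left (Subgroup.mem_sup_right ht)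
    · exact Subgroup.mem_sup_right ht

/-- (w) **Private vectors from the pair quotients.** `S₃ ↠ S₃ ⧸ ⟪Kⱼ ∪ Kₗ⟫ ≅ F₁ ↠ ℤ` abelianises to
an integer functional `χ` killing `L Kⱼ`, `L Kₗ` and onto; as `L K₀ + L K₁ + L K₂ = ℤ⁶`
(`triple`), some `wᵢ ∈ L Kᵢ` has `χ wᵢ = 1`. [folklore] -/
theorem exists_private_vector {K : TrisectionKernels 3} (hK : IsGroupTrisection 3 1 (PUnit : Type) K)
    (i : Fin 3) :
    ∃ w ∈ L (K i), ∃ χ : V3 →ₗ[ℤ] ℤ, χ w = 1 ∧ ∀ j, j ≠ i → ∀ v ∈ L (K j), χ v = 0 := by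
  obtain ⟨j, l, hjl, hji, hli, hcov⟩ := fin_three_others i
  obtain ⟨e⟩ := hK.free_pairQuotient j l hjl
  let τ : FreeGroup (Fin 1) →* Multiplicative ℤ := FreeGroup.lift fun _ => ofAdd 1
  let F : SurfaceGroup 3 →* Multiplicative ℤ :=
    τ.comp (e.symm.toMonoidHom.comp (QuotientGroup.mk' _))
  let χ : V3 →ₗ[ℤ] ℤ := factorAb F
  have hkill : ∀ t, t = j ∨ t = l → ∀ v ∈ L (K t), χ v = 0 := by
    intro t ht v hv
    obtain ⟨k, hk, hkv⟩ := mem_L.1 hv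
    have hv' : v = toAdd (ab k) := by rw [hkv, toAdd_ofAdd]
    have hk1 : (QuotientGroup.mk' (Subgroup.normalClosure ((K j : Set (SurfaceGroup 3)) ∪ K l)) k) = 1 := by
      rw [QuotientGroup.mk'_apply, QuotientGroup.eq_one_iff]
      refine Subgroup.subset_normalClosure ?_
      rcases ht with rfl | rfl
      · exact Or.inl hk
      · exact Or.inr hk
    rw [hv', factorAb_ab]
    change toAdd (τ (e.symm (QuotientGroup.mk' _ k))) = 0
    rw [hk1, map_one, map_one, toAdd_one]
  have hone : ∃ s : SurfaceGroup 3, χ (toAdd (ab s)) = 1 := by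
    obtain ⟨s, hs⟩ := QuotientGroup.mk_surjective (e (FreeGroup.of 0))
    refine ⟨s, ?_⟩
    rw [factorAb_ab]
    simp [F, τ, hs]
  obtain ⟨s, hs⟩ := hone
  have htop : toAdd (ab s) ∈ L (K i) ⊔ L (K j) ⊔ L (K l) := by
    rw [← L_sup, ← L_sup, sup_sup_eq_top_of_isGroupTrisection hK i j l hcov, L_top]
    exact Submodule.mem_top
  obtain ⟨y, hy, z, hz, hyz⟩ := Submodule.mem_sup.1 htop
  obtain ⟨a, ha, b, hb, rfl⟩ := Submodule.mem_sup.1 hy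
  refine ⟨a, ha, χ, ?_, fun t ht => hkill t (hcov t ht)⟩
  have : χ (a + b + z) = 1 := by rw [hyz]; exact hs
  rwa [map_add, map_add, hkill j (Or.inl rfl) b hb, hkill l (Or.inr rfl) z hz, add_zero, add_zero] at this

/-- (p) **Level automorphisms from standard shadows.** At the level `M_p` the shadow symmetry
`ψ_p` induces a linear automorphism of `(ZMod p)⁶` carrying the coordinate subspaces
`Cᵢ = L̄ Nᵢ` to the reduced lattices `L̄ Kᵢ`. [folklore] -/
theorem exists_level_equiv (K : TrisectionKernels 3)
    (hS : ∀ M : Subgroup (SurfaceGroup 3), M.Characteristic → M.FiniteIndex →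
      ∃ ψ : SurfaceGroup 3 ≃* SurfaceGroup 3, ∀ i : Fin 3,
        (s4Kernels i ⊔ M).map ψ.toMonoidHom = K i ⊔ M)
    (p : ℕ) (hp : p.Prime) :
    ∃ ψ : V3p p ≃ₗ[ZMod p] V3p p,
      ∀ i, (coord (ZMod p) (s4Gens i)).map (ψ : V3p p →ₗ[ZMod p] V3p p) = redSub p (L (K i)) := by
  haveI : NeZero p := ⟨hp.ne_zero⟩
  obtain ⟨ψ, hψ⟩ := hS (Mp p) inferInstance inferInstance
  refine ⟨abelpEquiv p ψ, fun i => ?_⟩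
  rw [← redSub_coord, ← L_s4Kernels]
  exact redSub_L_eq_of_level p ψ _ _ (hψ i)

/-- **Abelian standardness.** For a `(3,1)` group trisection `K` of the trivial group that is
Waldhausen-normalised (every pair of slots simultaneously standard) and shadow-standard in every
characteristic finite quotient, the abelianised triple `(L K₀, L K₁, L K₂)` of integer lattices in
`ℤ⁶ = H₁(Σ₃)` is the image of the coordinate triple of `N` under some `g ∈ GL₆(ℤ)`. [folklore] -/
theorem exists_adapted_equiv_of_shadows :
    ∀ K : TrisectionKernels 3, IsGroupTrisection 3 1 (PUnit : Type) K →
      (∀ i j : Fin 3, i ≠ j → ∃ α : SurfaceGroup 3 ≃* SurfaceGroup 3,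
        (s4Kernels i).map α.toMonoidHom = K i ∧ (s4Kernels j).map α.toMonoidHom = K j) →
      (∀ M : Subgroup (SurfaceGroup 3), M.Characteristic → M.FiniteIndex →
        ∃ ψ : SurfaceGroup 3 ≃* SurfaceGroup 3, ∀ i : Fin 3,
          (s4Kernels i ⊔ M).map ψ.toMonoidHom = K i ⊔ M) →
      ∃ g : V3 ≃ₗ[ℤ] V3, ∀ i, (coord ℤ (s4Gens i)).map (g : V3 →ₗ[ℤ] V3) = L (K i) :=
  fun K hK hP hS => exists_adapted_equiv (fun i => L (K i)) (exists_shared_vector K hP)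
    (exists_private_vector hK) (exists_level_equiv K hS)

/-! ## The lattice identity hands over `γ₂(H₀) × γ₂(H₁) × γ₂(H₂)` -/

/-- Three pairwise distinct elements exhaust `Fin 3`, with the two others named. [folklore] -/
private theorem fin_three_others' : ∀ i : Fin 3, ∃ j l : Fin 3, i ≠ j ∧ j ≠ l ∧ i ≠ l ∧
    ∀ t : Fin 3, t ≠ i → t = j ∨ t = l := by decide

/-- **Slot embedding.** For epimorphisms `φᵢ : S₃ ↠ H 0 i` whose kernels `Kᵢ` satisfy the lattice
identity `[S₃,S₃] ≤ Kᵢ(Kⱼ ∩ Kₗ)`, every element of `Π γ₂(H 0 i)` lies in the joint image of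
`(φ₀, φ₁, φ₂)`: for `h = φᵢ(x)`, `x ∈ [S₃,S₃]`, write `x = k·y` with `k ∈ Kᵢ`, `y ∈ Kⱼ ∩ Kₗ`;
then `(φ₀,φ₁,φ₂)(y)` is `h` in slot `i` and trivial elsewhere. [folklore] -/
theorem mem_range_pi_of_commutator (K' : TrisectionKernels 3) [∀ i, (K' i).Normal]
    (hlatK : ∀ i j l : Fin 3, i ≠ j → j ≠ l → i ≠ l →
      ⁅(⊤ : Subgroup (SurfaceGroup 3)), (⊤ : Subgroup (SurfaceGroup 3))⁆ ≤ K' i ⊔ (K' j ⊓ K' l))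
    (φ : ∀ i : Fin 3, SurfaceGroup 3 →* H 0 i) (hsurj : ∀ i, Function.Surjective (φ i))
    (hker : ∀ i, (φ i).ker = K' i) (t : T 0) (ht : ∀ i, t i ∈ commutator (H 0 i)) :
    t ∈ (MonoidHom.pi φ).range := by
  classical
  have hsingle : ∀ (i : Fin 3) (h : H 0 i), h ∈ commutator (H 0 i) →
      Pi.mulSingle i h ∈ (MonoidHom.pi φ).range := by
    intro i h hh
    obtain ⟨j, l, hij, hjl, hil, hcov⟩ := fin_three_others' i
    rw [commutator_def, ← Subgroup.map_top_of_surjective _ (hsurj i), ← Subgroup.map_commutator,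
      Subgroup.mem_map] at hh
    obtain ⟨x, hx, rfl⟩ := hh
    have hx' : x ∈ ((K' i ⊔ (K' j ⊓ K' l) : Subgroup (SurfaceGroup 3)) : Set (SurfaceGroup 3)) :=
      hlatK i j l hij hjl hil hx
    rw [Subgroup.normal_mul] at hx'
    obtain ⟨k, hk, y, hy, rfl⟩ := Set.mem_mul.1 hx'
    refine ⟨y, funext fun t => ?_⟩
    rw [MonoidHom.pi_apply]
    by_cases hti : t = i
    · subst hti
      have hk1 : φ t k = 1 := by rw [← MonoidHom.mem_ker, hker]; exact hk
      rw [Pi.mulSingle_eq_same, map_mul, hk1, one_mul]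
    · rw [Pi.mulSingle_eq_of_ne hti, ← MonoidHom.mem_ker, hker]
      rcases hcov t hti with rfl | rfl
      · exact hy.1
      · exact hy.2
  exact Subgroup.pi_mem_of_mulSingle_mem t fun i => hsingle i (t i) (ht i)

/-! ## Surviving generators of the standard handlebodies (used by the final file) -/

/-- The generators surviving in `H 0 i = S₃ ⧸ Nᵢ` (complement of `s4Gens i`): `(b₀,b₁,a₂)`,
`(b₀,a₁,b₂)`, `(a₀,b₁,b₂)`. -/
def surv (i : Fin 3) : Fin 3 → surfaceGen 3 :=
  ![![((0 : Fin 3), true), ((1 : Fin 3), true), ((2 : Fin 3), false)],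
    ![((0 : Fin 3), true), ((1 : Fin 3), false), ((2 : Fin 3), true)],
    ![((0 : Fin 3), false), ((1 : Fin 3), true), ((2 : Fin 3), true)]] i

/-- Surviving generators are not killed. [folklore] -/
theorem surv_not_mem : ∀ (i k : Fin 3), surv i k ∉ s4Gens i := by decide

/-- The enumeration is injective. [folklore] -/
theorem surv_inj : ∀ (i a b : Fin 3), surv i a = surv i b → a = b := by decide

/-- Every generator not killed survives. [folklore] -/
theorem exists_surv : ∀ (i : Fin 3) (x : surfaceGen 3), x ∉ s4Gens i → ∃ k, surv i k = x := by decide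

/-- The index of a surviving generator (junk value `0` on killed generators). -/
def survIdx (i : Fin 3) (x : surfaceGen 3) : Fin 3 :=
  if h : ∃ k, surv i k = x then Classical.choose h else 0

/-- `surv i (survIdx i x) = x` for a surviving `x`. [folklore] -/
theorem surv_survIdx {i : Fin 3} {x : surfaceGen 3} (hx : x ∉ s4Gens i) : surv i (survIdx i x) = x := by
  rw [survIdx, dif_pos (exists_surv i x hx)]; exact Classical.choose_spec (exists_surv i x hx)

/-- `survIdx i (surv i k) = k`. [folklore] -/
@[simp] theorem survIdx_surv (i k : Fin 3) : survIdx i (surv i k) = k :=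
  surv_inj i _ _ (surv_survIdx (surv_not_mem i k))

/-- `Fin 3 ≃ {surviving generators of slot i}`. -/
def survEquiv (i : Fin 3) : Fin 3 ≃ {x : surfaceGen 3 // x ∉ s4Gens i} where
  toFun k := ⟨surv i k, surv_not_mem i k⟩
  invFun x := survIdx i x.1
  left_inv k := survIdx_surv i k
  right_inv x := Subtype.ext (surv_survIdx x.2)

end Summit.SmoothPoincare4.SmoothPoincare4.Theorems.ShadowApproximation.EpiClassLivingston
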